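import Summits.RiemannHypothesis.RiemannHypothesis.Theorems.SoloInformedQuasiWeilStrip

/-!
# Exponential slack in Weil's criterion, VI: the Sobolev-normalised zero side

Solo programme `solo-RiemannHypothesis-informed`, session 2 — part of the exact-thermometer
package; the overview, the main theorem `width_iff_weilQuadratic_sobolev_subexp` and the
references are in `SoloInformedQuasiWeil.lean`. Everything here is proved (no named facts).

Unconditionally the weights `m(ρ)/(1+γ²)` have bounded local count (`exists_weighted_localCount`,
Jensen + reflection) and `(1+γ²)|ĝ(ρ)|² ≤ |ĝ(ρ)|² + |(g')^(ρ)|²`, whence the upper half of the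
thermometer: width `Θ` gives `Re Q(g) ≥ -C(1+a)³e^{Θa}(‖g‖₂² + ‖g'‖₂²)` for every test `g` on
`[-a, a]` (`zeroForm_re_ge_sobolev_of_width`).
-/

noncomputable section

open Complex Filter Set MeasureTheory
open scoped Real Topology ComplexConjugate ArithmeticFunction.vonMangoldt

namespace Summit.RiemannHypothesis.RiemannHypothesis.Theorems

open Literature.NumberTheory.LFunctions Literature.NumberTheory.LFunctions.WeilConverse

open intervalIntegral

variable {g : ℝ → ℂ}

/-! ### The Sobolev-normalised zero side: unconditional local count -/

/-- `(1 + (Im ρ)²) |ĝ(ρ)|² ≤ |ĝ(ρ)|² + |(g')^(ρ)|²` (integration by parts: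
`(g')^(ρ) = -(ρ - 1/2) ĝ(ρ)` and `|ρ - 1/2| ≥ |Im ρ|`). [folklore] -/
theorem one_add_im_sq_mul_norm_sq_weilMellin_le (hg : IsWeilTest g) (ρ : ℂ) :
    (1 + ρ.im ^ 2) * ‖weilMellin g ρ‖ ^ 2 ≤
      ‖weilMellin g ρ‖ ^ 2 + ‖weilMellin (deriv g) ρ‖ ^ 2 := by
  rw [weilMellin_deriv hg, norm_mul, norm_neg, mul_pow, Complex.sq_norm (ρ - 1 / 2),
    Complex.normSq_apply]
  have hre : (ρ - 1 / 2).im = ρ.im := by simp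
  have h1 : ρ.im ^ 2 ≤ (ρ - 1 / 2).re * (ρ - 1 / 2).re + (ρ - 1 / 2).im * (ρ - 1 / 2).im := by
    rw [hre]; nlinarith [mul_self_nonneg (ρ - 1 / 2).re]
  nlinarith [mul_le_mul_of_nonneg_right h1 (sq_nonneg ‖weilMellin g ρ‖)]

/-- **Weighted local count of the non-trivial zeros** (from Jensen's bound
`N(t + 1/2) − N(t − 1/2) ≪ log(|t| + 2)`, tree `exists_sum_zetaZeroWindow_le`, and the reflection
`ρ ↦ 1 − ρ̄` for the zeros left of `σ = 1/4`): there is `d` with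
`∑_{ρ ∈ T} m(ρ)/(1 + (Im ρ)²) ≤ d` for every finite set `T` of non-trivial zeros in a unit window
`|Im ρ − t| ≤ 1/2`. [cite: MontgomeryVaughan2007, Thm. 10.13] -/
theorem exists_weighted_localCount :
    ∃ d : ℝ, 0 ≤ d ∧ ∀ (t : ℝ) (T : Finset ZetaZeros.riemannZetaNontrivialZeros),
      (∀ ρ ∈ T, |(ρ : ℂ).im - t| ≤ 1 / 2) →
        ∑ ρ ∈ T, (riemannZetaZeroOrder (ρ : ℂ) : ℝ) / (1 + (ρ : ℂ).im ^ 2) ≤ d := by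
  classical
  obtain ⟨C, hC, hwin⟩ := exists_sum_zetaZeroWindow_le
  refine ⟨16 * C, by positivity, fun t T hT ↦ ?_⟩
  have hm0 : ∀ ρ : ZetaZeros.riemannZetaNontrivialZeros, (0 : ℝ) ≤ riemannZetaZeroOrder (ρ : ℂ) :=
    fun ρ ↦ riemannZetaZeroOrder_nonneg_of_zero
      (ZetaZeros.riemannZetaNontrivialZeros.zeta_eq_zero ρ.2)
  have hW0 : ∀ z ∈ (zetaZeroWindow_finite t).toFinset, (0 : ℝ) ≤ riemannZetaZeroOrder z := by
    intro z hz
    rw [Set.Finite.mem_toFinset] at hz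
    exact riemannZetaZeroOrder_nonneg_of_zero hz.1
  -- Step 1: the plain count `∑_{ρ ∈ T} m(ρ) ≤ 2 C log(|t| + 2)`
  set T₁ := T.filter (fun ρ : ZetaZeros.riemannZetaNontrivialZeros ↦ (1 : ℝ) / 4 ≤ (ρ : ℂ).re) with hT₁
  set T₂ := T.filter (fun ρ : ZetaZeros.riemannZetaNontrivialZeros ↦ ¬ (1 : ℝ) / 4 ≤ (ρ : ℂ).re)
    with hT₂
  have h1 : ∑ ρ ∈ T₁, (riemannZetaZeroOrder (ρ : ℂ) : ℝ) ≤ C * Real.log (|t| + 2) := by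
    refine le_trans ?_ (hwin t)
    have e : ∑ ρ ∈ T₁, (riemannZetaZeroOrder (ρ : ℂ) : ℝ) =
        ∑ z ∈ T₁.map (Function.Embedding.subtype _), (riemannZetaZeroOrder z : ℝ) := by
      rw [Finset.sum_map]
      rfl
    rw [e]
    refine Finset.sum_le_sum_of_subset_of_nonneg (fun z hz ↦ ?_) fun z hz _ ↦ hW0 z hz
    simp only [Finset.mem_map, Function.Embedding.coe_subtype, hT₁, Finset.mem_filter] at hz
    obtain ⟨ρ, ⟨hρT, hρre⟩, rfl⟩ := hz
    rw [Set.Finite.mem_toFinset]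
    exact ⟨ZetaZeros.riemannZetaNontrivialZeros.zeta_eq_zero ρ.2, hρre, hT ρ hρT⟩
  have h2 : ∑ ρ ∈ T₂, (riemannZetaZeroOrder (ρ : ℂ) : ℝ) ≤ C * Real.log (|t| + 2) := by
    refine le_trans ?_ (hwin t)
    set r : ZetaZeros.riemannZetaNontrivialZeros → ℂ := fun ρ ↦ 1 - conj (ρ : ℂ) with hr
    have hrinj : Set.InjOn r T₂ := by
      intro ρ _ ρ' _ h
      apply Subtype.ext
      have : conj (ρ : ℂ) = conj (ρ' : ℂ) := by
        simpa [hr] using h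
      simpa using congrArg conj this
    have e : ∑ ρ ∈ T₂, (riemannZetaZeroOrder (ρ : ℂ) : ℝ) =
        ∑ z ∈ T₂.image r, (riemannZetaZeroOrder z : ℝ) := by
      rw [Finset.sum_image hrinj]
      refine Finset.sum_congr rfl fun ρ _ ↦ ?_
      rw [hr]
      dsimp only
      rw [riemannZetaZeroOrder_one_sub_conj (ZetaZeros.riemannZetaNontrivialZeros.re_pos ρ.2)
        (ZetaZeros.riemannZetaNontrivialZeros.re_lt_one ρ.2)]
    rw [e]
    refine Finset.sum_le_sum_of_subset_of_nonneg (fun z hz ↦ ?_) fun z hz _ ↦ hW0 z hz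
    simp only [Finset.mem_image, hT₂, Finset.mem_filter] at hz
    obtain ⟨ρ, ⟨hρT, hρre⟩, rfl⟩ := hz
    rw [Set.Finite.mem_toFinset]
    have hmem := ZetaZeros.riemannZetaNontrivialZeros.one_sub_conj_mem ρ.2
    refine ⟨ZetaZeros.riemannZetaNontrivialZeros.zeta_eq_zero hmem, ?_, ?_⟩
    · simp only [hr, sub_re, one_re, Complex.conj_re]
      push Not at hρre
      linarith
    · simp only [hr, sub_im, one_im, Complex.conj_im, zero_sub, neg_neg]
      exact hT ρ hρT
  have hsum : ∑ ρ ∈ T, (riemannZetaZeroOrder (ρ : ℂ) : ℝ) ≤ 2 * (C * Real.log (|t| + 2)) := by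
    rw [← Finset.sum_filter_add_sum_filter_not T (fun ρ ↦ (1 : ℝ) / 4 ≤ (ρ : ℂ).re)]
    linarith
  -- Step 2: the weights `1/(1 + γ²) ≤ 4/(1 + t²)` on the window
  have hwt : ∀ ρ ∈ T, (riemannZetaZeroOrder (ρ : ℂ) : ℝ) / (1 + (ρ : ℂ).im ^ 2) ≤
      4 / (1 + t ^ 2) * riemannZetaZeroOrder (ρ : ℂ) := by
    intro ρ hρ
    have hγ := abs_le.1 (hT ρ hρ)
    rw [div_mul_eq_mul_div, div_le_div_iff₀ (by positivity) (by positivity)]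
    have hu : ((ρ : ℂ).im - t) ^ 2 ≤ 1 / 4 := by nlinarith [hγ.1, hγ.2]
    have : 1 + t ^ 2 ≤ 4 * (1 + (ρ : ℂ).im ^ 2) := by
      nlinarith [sq_nonneg (2 * (ρ : ℂ).im - t)]
    nlinarith [hm0 ρ]
  -- Step 3: assemble
  have hlog : Real.log (|t| + 2) ≤ 2 * (1 + t ^ 2) := by
    have := Real.log_le_sub_one_of_pos (show 0 < |t| + 2 by positivity)
    nlinarith [abs_nonneg t, sq_abs t]
  calc ∑ ρ ∈ T, (riemannZetaZeroOrder (ρ : ℂ) : ℝ) / (1 + (ρ : ℂ).im ^ 2)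
      ≤ ∑ ρ ∈ T, 4 / (1 + t ^ 2) * riemannZetaZeroOrder (ρ : ℂ) := Finset.sum_le_sum hwt
    _ = 4 / (1 + t ^ 2) * ∑ ρ ∈ T, (riemannZetaZeroOrder (ρ : ℂ) : ℝ) := by rw [Finset.mul_sum]
    _ ≤ 4 / (1 + t ^ 2) * (2 * (C * Real.log (|t| + 2))) :=
        mul_le_mul_of_nonneg_left hsum (by positivity)
    _ = 8 * C * (Real.log (|t| + 2) / (1 + t ^ 2)) := by ring
    _ ≤ 8 * C * 2 := by
        refine mul_le_mul_of_nonneg_left ?_ (by positivity)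
        rw [div_le_iff₀ (by positivity)]
        exact hlog
    _ = 16 * C := by ring

/-- **The Sobolev-normalised zero side is quasi-positive at the rate of the width — no
clustering hypothesis.** If every non-trivial zero has `|Re ρ − 1/2| ≤ Θ/2`, then for all `a > 0`
and every test `g` supported in `[-a, a]`,
`Re Q(g) ≥ −C (1 + a)³ e^{Θa} (‖g‖₂² + ‖g'‖₂²)`. The point: the weights `m(ρ)/(1 + γ²)` have
bounded local count unconditionally (`exists_weighted_localCount`), and
`(1 + γ²)|ĝ(ρ)|² ≤ |ĝ(ρ)|² + |(g')^(ρ)|²`; so the strip sampling bound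
(`sum_mul_norm_sq_weilMellin_strip_le`) applies to `g` and to `g'`. [folklore] -/
theorem zeroForm_re_ge_sobolev_of_width {Θ : ℝ}
    (hΘ : ∀ ρ ∈ ZetaZeros.riemannZetaNontrivialZeros, |ρ.re - 1 / 2| ≤ Θ / 2) :
    ∃ C : ℝ, 0 ≤ C ∧ ∀ a : ℝ, 0 < a → ∀ g : ℝ → ℂ, IsWeilTest g → tsupport g ⊆ Icc (-a) a →
      -(C * (1 + a) ^ 3 * Real.exp (Θ * a)) * (weilNorm2Sq g + weilNorm2Sq (deriv g)) ≤
        (zeroForm g).re := by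
  classical
  obtain ⟨d, hd0, hd⟩ := exists_weighted_localCount
  by_cases hoff : ∃ ρ ∈ ZetaZeros.riemannZetaNontrivialZeros, ρ.re ≠ 1 / 2
  swap
  · push Not at hoff
    refine ⟨0, le_rfl, fun a ha g hg hsupp ↦ ?_⟩
    simp only [zero_mul, neg_zero]
    rw [zeroForm, Complex.re_tsum (summable_pairCoeff hg)]
    exact tsum_nonneg fun ρ ↦ re_order_mul_pairCoeff_nonneg_of_re_eq_half g (hoff ρ ρ.2)
  obtain ⟨ρ₀, hρ₀, hρ₀off⟩ := hoff
  have hΘpos : 0 < Θ := by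
    have h1 := hΘ ρ₀ hρ₀
    have h2 : 0 < |ρ₀.re - 1 / 2| := abs_pos.2 (sub_ne_zero.2 hρ₀off)
    linarith
  set C : ℝ := 6 * π * d * (1 + Θ) with hC
  refine ⟨C, by positivity, fun a ha g hg hsupp ↦ ?_⟩
  have hg' : IsWeilTest (deriv g) := hg.deriv
  have hsupp' : tsupport (deriv g) ⊆ Icc (-a) a := tsupport_deriv_subset.trans hsupp
  set N : ℝ := weilNorm2Sq g + weilNorm2Sq (deriv g) with hN
  have hN0 : 0 ≤ N := add_nonneg (integral_nonneg fun _ ↦ by positivity)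
    (integral_nonneg fun _ ↦ by positivity)
  rw [zeroForm, Complex.re_tsum (summable_pairCoeff hg)]
  set m : ZetaZeros.riemannZetaNontrivialZeros → ℝ := fun ρ ↦ (riemannZetaZeroOrder (ρ : ℂ) : ℝ)
    with hm
  have hm0 : ∀ ρ, 0 ≤ m ρ := fun ρ ↦ Int.cast_nonneg (by
    have := ZetaZeros.riemannZetaNontrivialZeros.one_le_order ρ.2
    omega)
  -- the weights `m/(1 + γ²)`
  set wt : ZetaZeros.riemannZetaNontrivialZeros → ℝ := fun ρ ↦ m ρ / (1 + (ρ : ℂ).im ^ 2) with hwt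
  have hwt0 : ∀ ρ, 0 ≤ wt ρ := fun ρ ↦ div_nonneg (hm0 ρ) (by positivity)
  have hmwt : ∀ ρ, m ρ = wt ρ * (1 + (ρ : ℂ).im ^ 2) := fun ρ ↦ by
    rw [hwt]; dsimp only; rw [div_mul_cancel₀ _ (by positivity)]
  set E : ZetaZeros.riemannZetaNontrivialZeros → ℝ := fun ρ ↦
    if (ρ : ℂ).re = 1 / 2 then 0 else
      m ρ / 2 * (‖weilMellin g ρ‖ ^ 2 + ‖weilMellin g (1 - conj (ρ : ℂ))‖ ^ 2) with hE
  have hE0 : ∀ ρ, 0 ≤ E ρ := by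
    intro ρ
    by_cases h : (ρ : ℂ).re = 1 / 2
    · simp [hE, h]
    · simp only [hE, h, if_false]
      exact mul_nonneg (div_nonneg (hm0 ρ) zero_le_two) (by positivity)
  have hptE : ∀ ρ, -E ρ ≤ ((riemannZetaZeroOrder (ρ : ℂ) : ℂ) * pairCoeff g ρ).re := by
    intro ρ
    by_cases hρ : (ρ : ℂ).re = 1 / 2
    · simp only [hE, hρ, if_true, neg_zero]
      exact re_order_mul_pairCoeff_nonneg_of_re_eq_half g hρ
    · simp only [hE, hρ, if_false]
      have h1 : -‖(riemannZetaZeroOrder (ρ : ℂ) : ℂ) * pairCoeff g ρ‖ ≤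
          ((riemannZetaZeroOrder (ρ : ℂ) : ℂ) * pairCoeff g ρ).re :=
        (abs_le.1 (Complex.abs_re_le_norm _)).1
      refine le_trans ?_ h1
      rw [neg_le_neg_iff, norm_mul, Complex.norm_intCast, abs_of_nonneg (hm0 ρ), pairCoeff,
        norm_mul, Complex.norm_conj]
      have hu := norm_nonneg (weilMellin g ρ)
      have hv := norm_nonneg (weilMellin g (1 - conj (ρ : ℂ)))
      have h2 : ‖weilMellin g ρ‖ * ‖weilMellin g (1 - conj (ρ : ℂ))‖ ≤
          (‖weilMellin g ρ‖ ^ 2 + ‖weilMellin g (1 - conj (ρ : ℂ))‖ ^ 2) / 2 := by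
        nlinarith [sq_nonneg (‖weilMellin g ρ‖ - ‖weilMellin g (1 - conj (ρ : ℂ))‖)]
      calc (riemannZetaZeroOrder (ρ : ℂ) : ℝ) * (‖weilMellin g ρ‖ * ‖weilMellin g (1 - conj (ρ : ℂ))‖)
          ≤ (riemannZetaZeroOrder (ρ : ℂ) : ℝ) *
              ((‖weilMellin g ρ‖ ^ 2 + ‖weilMellin g (1 - conj (ρ : ℂ))‖ ^ 2) / 2) :=
            mul_le_mul_of_nonneg_left h2 (hm0 ρ)
        _ = m ρ / 2 * (‖weilMellin g ρ‖ ^ 2 + ‖weilMellin g (1 - conj (ρ : ℂ))‖ ^ 2) := by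
            rw [hm]; ring
  -- the strip bound for `g` and `g'`
  set B : ℝ → ℝ := fun M ↦ 2 * π * d * (1 + Θ * a) * (3 + a ^ 2) * Real.exp (Θ * a) * M with hB
  have e1 : ∀ ρ : ZetaZeros.riemannZetaNontrivialZeros,
      (1 / 2 : ℂ) + (((ρ : ℂ).re - 1 / 2 : ℝ) : ℂ) + ((ρ : ℂ).im : ℂ) * I = (ρ : ℂ) := by
    intro ρ
    apply Complex.ext
    · simp
    · simp
  have e2 : ∀ ρ : ZetaZeros.riemannZetaNontrivialZeros,
      (1 / 2 : ℂ) + ((-((ρ : ℂ).re - 1 / 2) : ℝ) : ℂ) + ((ρ : ℂ).im : ℂ) * I = 1 - conj (ρ : ℂ) := by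
    intro ρ
    apply Complex.ext
    · simp; ring
    · simp
  have him2 : ∀ ρ : ZetaZeros.riemannZetaNontrivialZeros, (1 - conj (ρ : ℂ)).im = (ρ : ℂ).im :=
    fun ρ ↦ by simp
  have hpartial : ∀ T : Finset ZetaZeros.riemannZetaNontrivialZeros, ∑ ρ ∈ T, E ρ ≤ B N := by
    intro T
    set T' := T.filter (fun ρ : ZetaZeros.riemannZetaNontrivialZeros ↦ (ρ : ℂ).re ≠ 1 / 2) with hT'
    have hsumE : ∑ ρ ∈ T, E ρ =
        ∑ ρ ∈ T', m ρ / 2 * (‖weilMellin g ρ‖ ^ 2 + ‖weilMellin g (1 - conj (ρ : ℂ))‖ ^ 2) := by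
      rw [hT', Finset.sum_filter]
      refine Finset.sum_congr rfl fun ρ _ ↦ ?_
      by_cases h : (ρ : ℂ).re = 1 / 2 <;> simp [hE, h]
    have hβ : ∀ ρ ∈ T', |(ρ : ℂ).re - 1 / 2| ≤ Θ / 2 := fun ρ _ ↦ hΘ ρ ρ.2
    have hβ' : ∀ ρ ∈ T', |(-((ρ : ℂ).re - 1 / 2))| ≤ Θ / 2 := fun ρ h ↦ by
      rw [abs_neg]; exact hβ ρ h
    have hloc : ∀ t : ℝ,
        ∑ ρ ∈ T'.filter (fun ρ : ZetaZeros.riemannZetaNontrivialZeros ↦ |(ρ : ℂ).im - t| ≤ 1 / 2), wt ρ ≤ d := by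
      intro t
      refine hd t _ fun ρ hρ ↦ ?_
      simp only [hT', Finset.mem_filter] at hρ
      exact hρ.2
    -- four strip bounds
    have hA := sum_mul_norm_sq_weilMellin_strip_le T'
      (fun ρ : ZetaZeros.riemannZetaNontrivialZeros ↦ (ρ : ℂ).re - 1 / 2)
      (fun ρ : ZetaZeros.riemannZetaNontrivialZeros ↦ (ρ : ℂ).im) wt hwt0 hΘpos hβ hloc hg ha hsupp
    have hA' := sum_mul_norm_sq_weilMellin_strip_le T'
      (fun ρ : ZetaZeros.riemannZetaNontrivialZeros ↦ -((ρ : ℂ).re - 1 / 2))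
      (fun ρ : ZetaZeros.riemannZetaNontrivialZeros ↦ (ρ : ℂ).im) wt hwt0 hΘpos hβ' hloc hg ha hsupp
    have hD := sum_mul_norm_sq_weilMellin_strip_le T'
      (fun ρ : ZetaZeros.riemannZetaNontrivialZeros ↦ (ρ : ℂ).re - 1 / 2)
      (fun ρ : ZetaZeros.riemannZetaNontrivialZeros ↦ (ρ : ℂ).im) wt hwt0 hΘpos hβ hloc hg' ha hsupp'
    have hD' := sum_mul_norm_sq_weilMellin_strip_le T'
      (fun ρ : ZetaZeros.riemannZetaNontrivialZeros ↦ -((ρ : ℂ).re - 1 / 2))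
      (fun ρ : ZetaZeros.riemannZetaNontrivialZeros ↦ (ρ : ℂ).im) wt hwt0 hΘpos hβ' hloc hg' ha hsupp'
    simp only [e1, e2] at hA hA' hD hD'
    -- `m |ĝ(ρ)|² ≤ wt (|ĝ(ρ)|² + |(g')^(ρ)|²)`
    have hk1 : ∀ ρ : ZetaZeros.riemannZetaNontrivialZeros,
        m ρ * ‖weilMellin g ρ‖ ^ 2 ≤
          wt ρ * ‖weilMellin g ρ‖ ^ 2 + wt ρ * ‖weilMellin (deriv g) ρ‖ ^ 2 := by
      intro ρ
      rw [hmwt ρ, mul_assoc, ← mul_add]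
      exact mul_le_mul_of_nonneg_left (one_add_im_sq_mul_norm_sq_weilMellin_le hg _) (hwt0 ρ)
    have hk2 : ∀ ρ : ZetaZeros.riemannZetaNontrivialZeros,
        m ρ * ‖weilMellin g (1 - conj (ρ : ℂ))‖ ^ 2 ≤
          wt ρ * ‖weilMellin g (1 - conj (ρ : ℂ))‖ ^ 2 +
            wt ρ * ‖weilMellin (deriv g) (1 - conj (ρ : ℂ))‖ ^ 2 := by
      intro ρ
      have := one_add_im_sq_mul_norm_sq_weilMellin_le hg (1 - conj (ρ : ℂ))
      rw [him2] at this
      rw [hmwt ρ, mul_assoc, ← mul_add]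
      exact mul_le_mul_of_nonneg_left this (hwt0 ρ)
    calc ∑ ρ ∈ T, E ρ
        = ∑ ρ ∈ T', m ρ / 2 * (‖weilMellin g ρ‖ ^ 2 + ‖weilMellin g (1 - conj (ρ : ℂ))‖ ^ 2) := hsumE
      _ = (1 / 2) * (∑ ρ ∈ T', m ρ * ‖weilMellin g ρ‖ ^ 2 +
            ∑ ρ ∈ T', m ρ * ‖weilMellin g (1 - conj (ρ : ℂ))‖ ^ 2) := by
          rw [← Finset.sum_add_distrib, Finset.mul_sum]
          refine Finset.sum_congr rfl fun ρ _ ↦ ?_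
          ring
      _ ≤ (1 / 2) * ((∑ ρ ∈ T', wt ρ * ‖weilMellin g ρ‖ ^ 2 +
              ∑ ρ ∈ T', wt ρ * ‖weilMellin (deriv g) ρ‖ ^ 2) +
            (∑ ρ ∈ T', wt ρ * ‖weilMellin g (1 - conj (ρ : ℂ))‖ ^ 2 +
              ∑ ρ ∈ T', wt ρ * ‖weilMellin (deriv g) (1 - conj (ρ : ℂ))‖ ^ 2)) := by
          have h₁ : ∑ ρ ∈ T', m ρ * ‖weilMellin g ρ‖ ^ 2 ≤
              ∑ ρ ∈ T', wt ρ * ‖weilMellin g ρ‖ ^ 2 +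
                ∑ ρ ∈ T', wt ρ * ‖weilMellin (deriv g) ρ‖ ^ 2 := by
            rw [← Finset.sum_add_distrib]
            exact Finset.sum_le_sum fun ρ _ ↦ hk1 ρ
          have h₂ : ∑ ρ ∈ T', m ρ * ‖weilMellin g (1 - conj (ρ : ℂ))‖ ^ 2 ≤
              ∑ ρ ∈ T', wt ρ * ‖weilMellin g (1 - conj (ρ : ℂ))‖ ^ 2 +
                ∑ ρ ∈ T', wt ρ * ‖weilMellin (deriv g) (1 - conj (ρ : ℂ))‖ ^ 2 := by
            rw [← Finset.sum_add_distrib]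
            exact Finset.sum_le_sum fun ρ _ ↦ hk2 ρ
          linarith
      _ ≤ (1 / 2) * ((B (weilNorm2Sq g) + B (weilNorm2Sq (deriv g))) +
            (B (weilNorm2Sq g) + B (weilNorm2Sq (deriv g)))) := by
          gcongr
      _ = B N := by rw [hB, hN]; ring
  have hEs : Summable E := summable_of_sum_le hE0 hpartial
  have hEt : ∑' ρ, E ρ ≤ B N := hEs.tsum_le_of_sum_le hpartial
  have hsum : Summable fun ρ : ZetaZeros.riemannZetaNontrivialZeros ↦
      ((riemannZetaZeroOrder (ρ : ℂ) : ℂ) * pairCoeff g ρ).re :=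
    (Complex.hasSum_re (summable_pairCoeff hg).hasSum).summable
  have hge : -B N ≤ ∑' ρ : ZetaZeros.riemannZetaNontrivialZeros,
      ((riemannZetaZeroOrder (ρ : ℂ) : ℂ) * pairCoeff g ρ).re := by
    calc -B N ≤ -∑' ρ, E ρ := neg_le_neg hEt
      _ = ∑' ρ, -E ρ := tsum_neg.symm
      _ ≤ _ := hEs.neg.tsum_le_tsum hptE hsum
  refine le_trans ?_ hge
  rw [neg_mul, neg_le_neg_iff, hB]
  dsimp only
  have h1 : 1 + Θ * a ≤ (1 + Θ) * (1 + a) := by nlinarith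
  have h2 : 3 + a ^ 2 ≤ 3 * (1 + a) ^ 2 := by nlinarith
  calc 2 * π * d * (1 + Θ * a) * (3 + a ^ 2) * Real.exp (Θ * a) * N
      = 2 * π * d * ((1 + Θ * a) * (3 + a ^ 2)) * Real.exp (Θ * a) * N := by ring
    _ ≤ 2 * π * d * ((1 + Θ) * (1 + a) * (3 * (1 + a) ^ 2)) * Real.exp (Θ * a) * N := by
        gcongr
    _ = C * (1 + a) ^ 3 * Real.exp (Θ * a) * N := by rw [hC]; ring

end Summit.RiemannHypothesis.RiemannHypothesis.Theorems
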